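import Summits.AtomisticToContinuum.Crystallization.Theorems.PerronTransitivityUniformBindingRigidityCohesionD
import Summits.AtomisticToContinuum.Crystallization.Theorems.PerronTransitivityUniformBindingRigidityCohesionF

/-!
# Cohesion of uniformly bound Lennard-Jones configurations, VII: only thick half-spaces remain

Helper file (`--supports stmt-AtomisticToContinuum-15099`) of the stub `stub_cohesion` of the line
`registered` (skeleton `Cruxes/UniformBindingRigidity/Lines/birth.lean`) of the crux
`Summit.AtomisticToContinuum.Crystallization.Theses.PerronTransitivity.UniformBindingRigidity`
(item stmt-AtomisticToContinuum-15099), combining part IV (`noHalfSpaceBinding_iff_cohesion`: the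
stub is equivalent to `(NHB)`, the non-existence of uniformly `2e*`-bound `1/4`-separated half-space
configurations through `0`) with part VI (`noSlabBinding`: thin ones, of bounded depth, do not exist).

`cohesion_of_noThickHalfSpaceBinding` / `noThickHalfSpaceBinding_iff_cohesion`: the stub
`stub_cohesion` is EQUIVALENT to

  `(NHB-thick)` every `1/4`-separated `Y ⊆ ℝ³` with `0 ∈ Y`, `Y ⊆ {⟪·, u⟫ ≤ 0}` (`‖u‖ = 1`) and
  points at every depth (`∀ t, ∃ q ∈ Y, ⟪q, u⟫ < −t`) has a site with Lennard-Jones site sum `> 2e*`,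

which is therefore the precise open core of the stub: a sitewise positive-surface-tension statement
for a free flat surface of BULK Lennard-Jones matter (Blanc–Lewin 2015, §2.3: open).

State of the stub after parts I–VII (worker of `stub_cohesion`, 2026-08-17):
* PROVED (tree): absolute separation `1/4` of uniformly bound sets (I); finite surface-cluster form
  `H ⇒ stub` (II); uniform site bounds pass to local limits (III); `stub ⇔ (NHB)` (IV);
  no uniformly bound slab (V–VI); `stub ⇔ (NHB-thick)` (here).
* OPEN: `(NHB-thick)`.  Why the route card's single-site plan (one-sided kissing `≤ 9` + half shells)
  cannot work: it needs separation `≳ 0.8` at the touching site — explicit `s`-separated half-space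
  configurations (heuristic search, `≈ 100` points) have single-site sums `≈ −1.54` (`s = 0.75`),
  `−1.43` (`0.775`), `−1.34` (`0.8`), `−1.18` (`0.85`), `−1.01` (`0.9`), against `2e* ≈ −1.435` — while
  a single-site separation bootstrap certifies `1/4` with the tree's packing constants and `≈ 0.75–0.8`
  at best with sharp ones.  Benchmark: the fcc(111) / hcp(0001)
  half-crystal at spacing `0.9712` has layer site sums `−0.993, −1.367, −1.416, −1.426, …` against the bulk
  `−1.431` (cutoff `6.5`): the physical margin is `0.44` in the surface layer only, and the missing proof
  must use the binding of the NEIGHBOURS of a surface site (multi-site), presumably computer-assisted.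

All `[folklore]`.
-/

noncomputable section

namespace Summit.AtomisticToContinuum.Crystallization.Theorems.PerronTransitivityUniformBindingRigidity

open scoped BigOperators Topology
open Filter Set Metric
open Literature.MathematicalPhysics.StatisticalMechanics
open Summit.AtomisticToContinuum.Crystallization.Theorems.ChargedEnergyGapNegative (E3 eStar)

/-! ## §12 Thin or thick -/

/-- **`(NHB-thick)` already gives `(NHB)`**: a half-space configuration is either thick (points at
every depth) or contained in a slab, and uniformly bound slabs do not exist (`noSlabBinding`).
[folklore] -/
theorem noHalfSpaceBinding_of_thick
    (H : ∀ (Y : Set (EuclideanSpace ℝ (Fin 3))) (u : EuclideanSpace ℝ (Fin 3)), ‖u‖ = 1 →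
      (0 : EuclideanSpace ℝ (Fin 3)) ∈ Y →
      (∀ p ∈ Y, ∀ q ∈ Y, p ≠ q → 1 / 4 ≤ dist p q) →
      (∀ q ∈ Y, inner ℝ q u ≤ 0) →
      (∀ t : ℝ, ∃ q ∈ Y, inner ℝ q u < -t) →
      ∃ p ∈ Y, 2 * (⨅ Q : PeriodicConfiguration 3, Q.energyPerParticle lennardJones) <
        ∑' q : {q : EuclideanSpace ℝ (Fin 3) // q ∈ Y ∧ q ≠ p}, lennardJones (dist p q.1)) :
    ∀ (Y : Set (EuclideanSpace ℝ (Fin 3))) (u : EuclideanSpace ℝ (Fin 3)), ‖u‖ = 1 →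
      (0 : EuclideanSpace ℝ (Fin 3)) ∈ Y →
      (∀ p ∈ Y, ∀ q ∈ Y, p ≠ q → 1 / 4 ≤ dist p q) →
      (∀ q ∈ Y, inner ℝ q u ≤ 0) →
      ∃ p ∈ Y, 2 * (⨅ Q : PeriodicConfiguration 3, Q.energyPerParticle lennardJones) <
        ∑' q : {q : EuclideanSpace ℝ (Fin 3) // q ∈ Y ∧ q ≠ p}, lennardJones (dist p q.1) := by
  intro Y u hu h0 hsep hhalf
  by_cases hthick : ∀ t : ℝ, ∃ q ∈ Y, inner ℝ q u < -t
  · exact H Y u hu h0 hsep hhalf hthick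
  · push Not at hthick
    obtain ⟨t, ht⟩ := hthick
    exact noSlabBinding (T := t) hu h0 hsep fun q hq => ⟨ht q hq, hhalf q hq⟩

/-- **Cohesion (`stub_cohesion`) from `(NHB-thick)`**: if no THICK uniformly `2e*`-bound
`1/4`-separated half-space configuration through `0` exists, every non-empty uniformly discrete
uniformly `2e*`-bound `X ⊆ ℝ³` is relatively dense (parts IV and VI). [folklore] -/
theorem cohesion_of_noThickHalfSpaceBinding
    (H : ∀ (Y : Set (EuclideanSpace ℝ (Fin 3))) (u : EuclideanSpace ℝ (Fin 3)), ‖u‖ = 1 →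
      (0 : EuclideanSpace ℝ (Fin 3)) ∈ Y →
      (∀ p ∈ Y, ∀ q ∈ Y, p ≠ q → 1 / 4 ≤ dist p q) →
      (∀ q ∈ Y, inner ℝ q u ≤ 0) →
      (∀ t : ℝ, ∃ q ∈ Y, inner ℝ q u < -t) →
      ∃ p ∈ Y, 2 * (⨅ Q : PeriodicConfiguration 3, Q.energyPerParticle lennardJones) <
        ∑' q : {q : EuclideanSpace ℝ (Fin 3) // q ∈ Y ∧ q ≠ p}, lennardJones (dist p q.1)) :
    ∀ X : Set (EuclideanSpace ℝ (Fin 3)), X.Nonempty →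
      (∃ δ : ℝ, 0 < δ ∧ ∀ p ∈ X, ∀ q ∈ X, p ≠ q → δ ≤ dist p q) →
      (∀ p ∈ X, ∑' q : {q : EuclideanSpace ℝ (Fin 3) // q ∈ X ∧ q ≠ p},
          lennardJones (dist p q.1) ≤
        2 * ⨅ Q : PeriodicConfiguration 3, Q.energyPerParticle lennardJones) →
      ∃ R : ℝ, ∀ y : EuclideanSpace ℝ (Fin 3), ∃ p ∈ X, dist y p ≤ R :=
  cohesion_of_noHalfSpaceBinding (noHalfSpaceBinding_of_thick H)

/-- **The stub is EQUIVALENT to `(NHB-thick)`** (with `noHalfSpaceBinding_iff_cohesion`; the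
converse restricts `(NHB)` to thick configurations). [folklore] -/
theorem noThickHalfSpaceBinding_iff_cohesion :
    (∀ (Y : Set (EuclideanSpace ℝ (Fin 3))) (u : EuclideanSpace ℝ (Fin 3)), ‖u‖ = 1 →
      (0 : EuclideanSpace ℝ (Fin 3)) ∈ Y →
      (∀ p ∈ Y, ∀ q ∈ Y, p ≠ q → 1 / 4 ≤ dist p q) →
      (∀ q ∈ Y, inner ℝ q u ≤ 0) →
      (∀ t : ℝ, ∃ q ∈ Y, inner ℝ q u < -t) →
      ∃ p ∈ Y, 2 * (⨅ Q : PeriodicConfiguration 3, Q.energyPerParticle lennardJones) <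
        ∑' q : {q : EuclideanSpace ℝ (Fin 3) // q ∈ Y ∧ q ≠ p}, lennardJones (dist p q.1)) ↔
    ∀ X : Set (EuclideanSpace ℝ (Fin 3)), X.Nonempty →
      (∃ δ : ℝ, 0 < δ ∧ ∀ p ∈ X, ∀ q ∈ X, p ≠ q → δ ≤ dist p q) →
      (∀ p ∈ X, ∑' q : {q : EuclideanSpace ℝ (Fin 3) // q ∈ X ∧ q ≠ p},
          lennardJones (dist p q.1) ≤
        2 * ⨅ Q : PeriodicConfiguration 3, Q.energyPerParticle lennardJones) →
      ∃ R : ℝ, ∀ y : EuclideanSpace ℝ (Fin 3), ∃ p ∈ X, dist y p ≤ R :=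
  ⟨cohesion_of_noThickHalfSpaceBinding,
    fun hC Y u hu h0 hsep hhalf _ => noHalfSpaceBinding_iff_cohesion.2 hC Y u hu h0 hsep hhalf⟩

/-! ## Registered sub-goal of `stub_cohesion`: the thick reduction -/

/-- **Sub-goal `stub_cohesion_of_noThickHalfSpaceBinding` of the stub `stub_cohesion`** (registered
on stmt-AtomisticToContinuum-15099): `(NHB-thick)` implies the stub verbatim
(`cohesion_of_noThickHalfSpaceBinding` in arrow form); by `noThickHalfSpaceBinding_iff_cohesion` the
antecedent is equivalent to the stub and is its open core. [folklore] -/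
theorem stub_cohesion_of_noThickHalfSpaceBinding :
    (∀ (Y : Set (EuclideanSpace ℝ (Fin 3))) (u : EuclideanSpace ℝ (Fin 3)), ‖u‖ = 1 →
      (0 : EuclideanSpace ℝ (Fin 3)) ∈ Y →
      (∀ p ∈ Y, ∀ q ∈ Y, p ≠ q → 1 / 4 ≤ dist p q) →
      (∀ q ∈ Y, inner ℝ q u ≤ 0) →
      (∀ t : ℝ, ∃ q ∈ Y, inner ℝ q u < -t) →
      ∃ p ∈ Y, 2 * (⨅ Q : PeriodicConfiguration 3, Q.energyPerParticle lennardJones) <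
        ∑' q : {q : EuclideanSpace ℝ (Fin 3) // q ∈ Y ∧ q ≠ p}, lennardJones (dist p q.1)) →
    ∀ X : Set (EuclideanSpace ℝ (Fin 3)), X.Nonempty →
      (∃ δ : ℝ, 0 < δ ∧ ∀ p ∈ X, ∀ q ∈ X, p ≠ q → δ ≤ dist p q) →
      (∀ p ∈ X, ∑' q : {q : EuclideanSpace ℝ (Fin 3) // q ∈ X ∧ q ≠ p},
          lennardJones (dist p q.1) ≤
        2 * ⨅ Q : PeriodicConfiguration 3, Q.energyPerParticle lennardJones) →
      ∃ R : ℝ, ∀ y : EuclideanSpace ℝ (Fin 3), ∃ p ∈ X, dist y p ≤ R :=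
  fun H => cohesion_of_noThickHalfSpaceBinding H

end Summit.AtomisticToContinuum.Crystallization.Theorems.PerronTransitivityUniformBindingRigidity

end
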